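import Literature.AlgebraicGeometry.ComplexMultiplication.SexticCMFourTypesSignRelation
import Literature.AlgebraicGeometry.Pohlmann1968.DivisorClassesCMAlgebra
import HarnessLib

/-!
# Four CM types of ONE sextic CM field: an explicit exceptional Hodge class of type `(2,2)` on the product
# `X₀ × X₁ × X₂ × X₃` of their realisations

COR-CM (cell `pub-hodgecm2`), seat p2 gen 21; count-neutral; theorems only, no definition, no named fact, no `sorry`.
Sequel of `CorCM/GenericCMFieldSameFieldFamiliesHodge` (pair-flip fields: four pairwise non-isogenous CM abelian
varieties with CM by a sextic pair-flip field carry an exceptional class on SOME product, by the Hazama–Murty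
criterion).  Here the class is LOCATED, and the pair-flip hypothesis is REMOVED:

* §1 (file `CorCM/SexticCMFourTypesSignRelation`): for ANY sextic CM field `K` and any four CM types `Φ_i` with
  `Φ_j ∉ {Φ_i, Φ̄_i}` the type vectors satisfy a SIGN RELATION `Σ_i η_i u_{Φ_i} = 0`, `η_i = ±1`
  (`exists_sign_relation_of_finrank_eq_six`).
* §2 THE BALANCED SET.  For ANY CM field and four types with a sign relation, the `4`-set
  `S = {(i, s^{η_i})}_i ⊆ ⊔_i Hom(K, ℂ)` (`s⁺ = s`, `s⁻ = s̄`, any embedding `s`) is Galois-balanced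
  (`mem_pohlmannSetsAlg_two`: under `τ ∈ Aut(ℂ)` the four memberships `[τ s^{η_i} ∈ Φ_i]` are the signs
  `η_i u_{Φ_i}(τ s)`, which sum to `0`, so exactly two hold), and is not a disjoint union of two balanced pairs when the
  types are pairwise inequivalent (`not_mem_pohlmannDivisorSetsAlg_two`: a balanced pair `{(i, s^{η_i}), (j, s^{η_j})}`
  forces `η_i u_{Φ_i} = −η_j u_{Φ_j}`, i.e. `Φ_j ∈ {Φ_i, Φ̄_i}`, by transitivity of `Aut(ℂ)` on `Hom(K, ℂ)`).
* §3 GEOMETRY (`Pohlmann1968_thm1_cmAlgebra` via `exists_exceptional_biproduct_iff`): for every family of realisations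
  `X_i` of the `Φ_i` — **`exists_exceptional_two_biproduct_of_signRelation`** (any CM field, four pairwise inequivalent
  types with a sign relation) and **`exists_exceptional_two_biproduct_of_finrank_eq_six`** (ANY SEXTIC CM field, any
  four pairwise inequivalent CM types; e.g. four pairwise non-isogenous simple CM abelian threefolds with CM by `K`,
  `exists_exceptional_two_biproduct_of_not_isIsogenous`): **the 12-fold `X₀ × X₁ × X₂ × X₃` carries a rational
  `(2,2)`-class outside the `ℂ`-span of products of divisor classes** (it lives in the Künneth component
  `H¹(X₀)⊗H¹(X₁)⊗H¹(X₂)⊗H¹(X₃)`).  Whether such classes are algebraic is open.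

Provenance: Literature home (namespace `Literature.AlgebraicGeometry.ComplexMultiplication.GenericCMField`) of the Summits-side `CorCM/SexticCMFourTypesExceptionalClass` (cell `pub-hodgecm2`, COR-CM; all its imports are `Literature/`, Mathlib and the already re-homed `SexticCMFourTypesSignRelation`), which `Literature/` may not import; theorems only, no named fact, no definition. Nothing here bears on `HC_CM`. Lane `lit-hodgefound` (Layer A3: CM types, their Kubota ranks and Galois combinatorics), seat p20.
-/

noncomputable section

open _root_.CategoryTheory _root_.CategoryTheory.Limits NumberField NumberField.ComplexEmbedding
open scoped BigOperators

namespace Literature.AlgebraicGeometry.ComplexMultiplication.GenericCMField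

open Literature.NumberTheory.ComplexMultiplication Literature.AlgebraicGeometry.HodgeTheory Literature.AlgebraicGeometry.Pohlmann1968

open Literature.NumberTheory.ComplexMultiplication
open Literature.AlgebraicGeometry.Motives (AbelianVariety CMType)
open Literature.AlgebraicGeometry.HodgeTheory
open Literature.AlgebraicGeometry.ComplexMultiplication (IsCMTypeRealisation)
open Literature.AlgebraicGeometry.VanGeemen1994 (hodgeClassSpan)
open Literature.AlgebraicGeometry.Pohlmann1968
open Literature.Barriers.HodgeConjecture (divisorClassesSpan)

/-! ## §0 Counting helpers -/

section Counting

/-- `#{x ∈ s | Q x}` as a sum of indicators. [cite: Dodson1984, §3.2 and Thm. 3.3] -/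
private theorem ncard_sep_eq_sum {α : Type*} (s : Finset α) (Q : α → Prop) [DecidablePred Q] :
    {x | x ∈ s ∧ Q x}.ncard = ∑ x ∈ s, if Q x then 1 else 0 := by
  have h : {x | x ∈ s ∧ Q x} = ↑(s.filter Q) := by
    ext x
    simp
  rw [h, Set.ncard_coe_finset, Finset.card_filter]

/-- A sum over four distinct points. [cite: Dodson1984, §3.2 and Thm. 3.3] -/
private theorem sum_quad {α N : Type*} [DecidableEq α] [AddCommMonoid N] {a b c d : α} (hab : a ≠ b) (hac : a ≠ c)
    (had : a ≠ d) (hbc : b ≠ c) (hbd : b ≠ d) (hcd : c ≠ d) (f : α → N) :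
    ∑ x ∈ ({a, b, c, d} : Finset α), f x = f a + f b + f c + f d := by
  rw [Finset.sum_insert (by simp [hab, hac, had]), Finset.sum_insert (by simp [hbc, hbd]), Finset.sum_pair hcd]
  simp only [add_assoc]

/-- Four distinct points form a `4`-set. [cite: Dodson1984, §3.2 and Thm. 3.3] -/
private theorem card_quad {α : Type*} [DecidableEq α] {a b c d : α} (hab : a ≠ b) (hac : a ≠ c) (had : a ≠ d)
    (hbc : b ≠ c) (hbd : b ≠ d) (hcd : c ≠ d) : ({a, b, c, d} : Finset α).card = 4 := by
  rw [Finset.card_insert_of_notMem (by simp [hab, hac, had]), Finset.card_insert_of_notMem (by simp [hbc, hbd]),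
    Finset.card_pair hcd]

/-- Four propositions whose signs `±1` (`+1` iff true) sum to `0`: exactly two hold. [cite: Dodson1984, §3.2 and Thm. 3.3] -/
private theorem ite_balance_of_sum {A B C D : Prop} [Decidable A] [Decidable B] [Decidable C] [Decidable D]
    {a b c d : ℚ} (ha : a = if A then 1 else -1) (hb : b = if B then 1 else -1) (hc : c = if C then 1 else -1)
    (hd : d = if D then 1 else -1) (hsum : a + b + c + d = 0) :
    (if A then 1 else 0) + (if B then 1 else 0) + (if C then 1 else 0) + (if D then 1 else 0) =
      (if ¬A then 1 else 0) + (if ¬B then 1 else 0) + (if ¬C then 1 else 0) + (if ¬D then 1 else 0) := by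
  subst ha hb hc hd
  by_cases hA : A <;> by_cases hB : B <;> by_cases hC : C <;> by_cases hD : D <;> simp_all <;> norm_num at hsum

/-- A balanced pair has exactly one member in the type. [cite: Dodson1984, §3.2 and Thm. 3.3] -/
private theorem iff_not_of_ite_add {A B : Prop} [Decidable A] [Decidable B]
    (h : (if A then 1 else 0) + (if B then 1 else 0) = (if ¬A then 1 else 0) + (if ¬B then 1 else 0)) :
    A ↔ ¬B := by
  by_cases hA : A <;> by_cases hB : B <;> simp_all

/-- Products of signs are signs. [cite: Dodson1984, §3.2 and Thm. 3.3] -/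
private theorem sign_mul {x y : ℚ} (hx : x = 1 ∨ x = -1) (hy : y = 1 ∨ y = -1) : x * y = 1 ∨ x * y = -1 := by
  rcases hx with rfl | rfl <;> rcases hy with rfl | rfl <;> norm_num

/-- Two signs of which exactly one is `+1` are opposite. [cite: Dodson1984, §3.2 and Thm. 3.3] -/
private theorem eq_neg_of_iff {a b : ℚ} (ha : a = 1 ∨ a = -1) (hb : b = 1 ∨ b = -1) (h : a = 1 ↔ ¬b = 1) :
    a = -b := by
  rcases ha with rfl | rfl <;> rcases hb with rfl | rfl
  · norm_num at h
  · norm_num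
  · norm_num
  · norm_num at h

end Counting

/-! ## §2 The balanced `4`-set of a sign relation (any CM field) -/

section Balanced

open scoped Classical

variable {K : Type} [Field K] [NumberField K] [IsCMField K]

/-- `s⁺ = s`, `s⁻ = s̄`: the membership of the embedding attached to a sign, read off the type vector. [cite: Dodson1984, §3.2 and Thm. 3.3] -/
private theorem sgnEmb_mem_iff (Φ : CMType K) {η : ℚ} (hη : η = 1 ∨ η = -1) (τ : ℂ ≃+* ℂ) (s : K →+* ℂ) :
    (τ : ℂ →+* ℂ).comp (if η = 1 then s else conjugate s) ∈ Φ.1 ↔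
      η * antiVec Φ.1 (1 : ℂ ≃+* ℂ) (τ • s) = 1 := by
  have hodd : antiVec Φ.1 (1 : ℂ ≃+* ℂ) (τ • conjugate s) = -antiVec Φ.1 (1 : ℂ ≃+* ℂ) (τ • s) := by
    have h := (isCMTypeWith_conj Φ).translateInd_rho_smul (1 : ℂ ≃+* ℂ) (τ • s)
    rw [← smul_conj_smul, conj_smul_eq_conjugate] at h
    simp only [antiVec]
    rw [h]
    ring
  rcases hη with rfl | rfl
  · rw [if_pos rfl, one_mul, antiVec_one_apply_eq_one_iff]
    rfl
  · rw [if_neg (by norm_num)]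
    change τ • conjugate s ∈ Φ.1 ↔ _
    rw [← antiVec_one_apply_eq_one_iff, hodd]
    constructor <;> intro h <;> linarith

omit [NumberField K] [IsCMField K] in
/-- The four points `(i, s^{η_i})` are pairwise distinct (distinct slots). [cite: Dodson1984, §3.2 and Thm. 3.3] -/
private theorem sigma_ne {i j : Fin 4} (hij : i ≠ j) (a b : K →+* ℂ) :
    (⟨i, a⟩ : (k : Fin 4) × ((fun _ : Fin 4 => K) k →+* ℂ)) ≠ ⟨j, b⟩ :=
  fun h => hij (congrArg Sigma.fst h)

/-- **The `4`-set `S = {(i, s^{η_i})}_{i<4}` of a sign relation `Σ_i η_i u_{Φ_i} = 0` is Galois-balanced**: for every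
`τ ∈ Aut(ℂ)` exactly two of the `τ s^{η_i}` lie in their types (the four signs `η_i u_{Φ_i}(τ s)` sum to zero). [cite: Dodson1984, §3.2 and Thm. 3.3] -/
theorem mem_pohlmannSetsAlg_two (Φ : Fin 4 → CMType K) {η : Fin 4 → ℚ} (hη : ∀ i, η i = 1 ∨ η i = -1)
    (hrel : ∀ s : K →+* ℂ, ∑ i, η i * antiVec (Φ i).1 (1 : ℂ ≃+* ℂ) s = 0) (s : K →+* ℂ) :
    ({⟨0, if η 0 = 1 then s else conjugate s⟩, ⟨1, if η 1 = 1 then s else conjugate s⟩,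
        ⟨2, if η 2 = 1 then s else conjugate s⟩, ⟨3, if η 3 = 1 then s else conjugate s⟩} :
        Finset ((k : Fin 4) × ((fun _ : Fin 4 => K) k →+* ℂ))) ∈
      pohlmannSetsAlg (K := fun _ : Fin 4 => K) Φ 2 := by
  have h01 := sigma_ne (K := K) (show (0 : Fin 4) ≠ 1 by decide)
    (if η 0 = 1 then s else conjugate s) (if η 1 = 1 then s else conjugate s)
  have h02 := sigma_ne (K := K) (show (0 : Fin 4) ≠ 2 by decide)
    (if η 0 = 1 then s else conjugate s) (if η 2 = 1 then s else conjugate s)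
  have h03 := sigma_ne (K := K) (show (0 : Fin 4) ≠ 3 by decide)
    (if η 0 = 1 then s else conjugate s) (if η 3 = 1 then s else conjugate s)
  have h12 := sigma_ne (K := K) (show (1 : Fin 4) ≠ 2 by decide)
    (if η 1 = 1 then s else conjugate s) (if η 2 = 1 then s else conjugate s)
  have h13 := sigma_ne (K := K) (show (1 : Fin 4) ≠ 3 by decide)
    (if η 1 = 1 then s else conjugate s) (if η 3 = 1 then s else conjugate s)
  have h23 := sigma_ne (K := K) (show (2 : Fin 4) ≠ 3 by decide)
    (if η 2 = 1 then s else conjugate s) (if η 3 = 1 then s else conjugate s)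
  refine ⟨card_quad h01 h02 h03 h12 h13 h23, fun τ => ?_⟩
  rw [ncard_sep_eq_sum, ncard_sep_eq_sum, sum_quad h01 h02 h03 h12 h13 h23, sum_quad h01 h02 h03 h12 h13 h23]
  have hsum := hrel (τ • s)
  rw [Fin.sum_univ_four] at hsum
  refine ite_balance_of_sum (a := η 0 * antiVec (Φ 0).1 (1 : ℂ ≃+* ℂ) (τ • s))
    (b := η 1 * antiVec (Φ 1).1 (1 : ℂ ≃+* ℂ) (τ • s)) (c := η 2 * antiVec (Φ 2).1 (1 : ℂ ≃+* ℂ) (τ • s))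
    (d := η 3 * antiVec (Φ 3).1 (1 : ℂ ≃+* ℂ) (τ • s)) ?_ ?_ ?_ ?_ hsum
  all_goals
    rw [sgnEmb_mem_iff (Φ _) (hη _) τ s]
    rcases hη _ with h | h <;> rcases antiVec_one_apply_eq_or (Φ _) (τ • s) with h' | h' <;>
      (rw [h, h']; try norm_num)

/-- **… and is not a disjoint union of two balanced pairs when the types are pairwise inequivalent**
(`u_{Φ_j} ≠ ±u_{Φ_i}`): a balanced pair `{(i, s^{η_i}), (j, s^{η_j})}` would give `η_i u_{Φ_i}(τs) = −η_j u_{Φ_j}(τs)` for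
all `τ`, i.e. `u_{Φ_j} = ∓u_{Φ_i}` by transitivity of `Aut(ℂ)` on `Hom(K, ℂ)`. [cite: Dodson1984, §3.2 and Thm. 3.3] -/
theorem not_mem_pohlmannDivisorSetsAlg_two (Φ : Fin 4 → CMType K) {η : Fin 4 → ℚ} (hη : ∀ i, η i = 1 ∨ η i = -1)
    (hpair : ∀ i j, i ≠ j → antiVec (Φ j).1 (1 : ℂ ≃+* ℂ) ≠ antiVec (Φ i).1 (1 : ℂ ≃+* ℂ) ∧
      antiVec (Φ j).1 (1 : ℂ ≃+* ℂ) ≠ -antiVec (Φ i).1 (1 : ℂ ≃+* ℂ)) (s : K →+* ℂ) :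
    ({⟨0, if η 0 = 1 then s else conjugate s⟩, ⟨1, if η 1 = 1 then s else conjugate s⟩,
        ⟨2, if η 2 = 1 then s else conjugate s⟩, ⟨3, if η 3 = 1 then s else conjugate s⟩} :
        Finset ((k : Fin 4) × ((fun _ : Fin 4 => K) k →+* ℂ))) ∉
      pohlmannDivisorSetsAlg (K := fun _ : Fin 4 => K) Φ 2 := by
  classical
  set e : Fin 4 → (K →+* ℂ) := fun i => if η i = 1 then s else conjugate s with he
  set P : Finset ((k : Fin 4) × ((fun _ : Fin 4 => K) k →+* ℂ)) := {⟨0, e 0⟩, ⟨1, e 1⟩, ⟨2, e 2⟩, ⟨3, e 3⟩}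
    with hPdef
  intro hP
  rw [pohlmannDivisorSetsAlg_def] at hP
  obtain ⟨t₁, ht₁, t₂, ht₂, hdisj, hPst⟩ := mem_disjointUnionsOf_succ.1 hP
  obtain ⟨t₀, ht₀, t₁', ht₁', hdisj', rfl⟩ := mem_disjointUnionsOf_succ.1 ht₁
  rw [mem_disjointUnionsOf_zero] at ht₀
  subst ht₀
  have hmem : (⟨0, e 0⟩ : (k : Fin 4) × ((fun _ : Fin 4 => K) k →+* ℂ)) ∈ P := by simp [hPdef]
  -- a balanced pair `T ⊆ P` through `(0, e 0)`
  obtain ⟨T, hT, h0T, hTP⟩ : ∃ T ∈ pohlmannSetsAlg (K := fun _ : Fin 4 => K) Φ 1,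
      (⟨0, e 0⟩ : (k : Fin 4) × ((fun _ : Fin 4 => K) k →+* ℂ)) ∈ T ∧ T ⊆ P := by
    rw [hPst, Finset.mem_disjUnion, Finset.mem_disjUnion] at hmem
    rcases hmem with (h | h) | h
    · exact absurd h (Finset.notMem_empty _)
    · exact ⟨t₁', ht₁', h, fun x hx => by
        rw [hPst]; exact Finset.mem_disjUnion.2 (Or.inl (Finset.mem_disjUnion.2 (Or.inr hx)))⟩
    · exact ⟨t₂, ht₂, h, fun x hx => by rw [hPst]; exact Finset.mem_disjUnion.2 (Or.inr hx)⟩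
  obtain ⟨hTcard, hTbal⟩ := hT
  obtain ⟨x, y, hxy, hTxy⟩ := Finset.card_eq_two.1 (by simpa using hTcard)
  obtain ⟨w, hw0, hwP, hbal⟩ : ∃ w, w ≠ (⟨0, e 0⟩ : (k : Fin 4) × ((fun _ : Fin 4 => K) k →+* ℂ)) ∧ w ∈ P ∧
      IsGaloisBalancedAlg (K := fun _ : Fin 4 => K) Φ {⟨0, e 0⟩, w} := by
    rw [hTxy] at h0T hTP hTbal
    simp only [Finset.mem_insert, Finset.mem_singleton] at h0T
    rcases h0T with rfl | rfl
    · exact ⟨y, hxy.symm, hTP (by simp), hTbal⟩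
    · exact ⟨x, hxy, hTP (by simp), by rwa [Finset.pair_comm] at hTbal⟩
  -- the partner is `(j, e j)` for some `j ≠ 0`
  obtain ⟨j, hj0, rfl⟩ : ∃ j : Fin 4, j ≠ 0 ∧ w = ⟨j, e j⟩ := by
    have hwP' : w = ⟨0, e 0⟩ ∨ w = ⟨1, e 1⟩ ∨ w = ⟨2, e 2⟩ ∨ w = ⟨3, e 3⟩ := by simpa [hPdef] using hwP
    rcases hwP' with rfl | rfl | rfl | rfl
    · exact (hw0 rfl).elim
    · exact ⟨1, by decide, rfl⟩
    · exact ⟨2, by decide, rfl⟩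
    · exact ⟨3, by decide, rfl⟩
  -- exactly one member of the pair lies in the types, for every `τ`: `η₀ u₀(τs) = -η_j u_j(τs)`
  have hone : ∀ τ : ℂ ≃+* ℂ,
      η 0 * antiVec (Φ 0).1 (1 : ℂ ≃+* ℂ) (τ • s) = -(η j * antiVec (Φ j).1 (1 : ℂ ≃+* ℂ) (τ • s)) := by
    intro τ
    have h := hbal τ
    rw [ncard_sep_eq_sum, ncard_sep_eq_sum, Finset.sum_pair hw0.symm, Finset.sum_pair hw0.symm] at h
    have h' := iff_not_of_ite_add h
    change ((τ : ℂ →+* ℂ).comp (e 0) ∈ (Φ 0).1 ↔ ¬(τ : ℂ →+* ℂ).comp (e j) ∈ (Φ j).1) at h'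
    rw [he, sgnEmb_mem_iff (Φ 0) (hη 0) τ s, sgnEmb_mem_iff (Φ j) (hη j) τ s] at h'
    exact eq_neg_of_iff (sign_mul (hη 0) (antiVec_one_apply_eq_or _ _))
      (sign_mul (hη j) (antiVec_one_apply_eq_or _ _)) h'
  -- transitivity of `Aut(ℂ)` on `Hom(K, ℂ)`: `η₀ u₀ = -η_j u_j` everywhere
  haveI := isPretransitive_ringEquiv_complex (K := K)
  have hall : ∀ t : K →+* ℂ,
      η 0 * antiVec (Φ 0).1 (1 : ℂ ≃+* ℂ) t = -(η j * antiVec (Φ j).1 (1 : ℂ ≃+* ℂ) t) := fun t => by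
    obtain ⟨τ, rfl⟩ := MulAction.exists_smul_eq (ℂ ≃+* ℂ) s t
    exact hone τ
  rcases hη 0 with h0 | h0 <;> rcases hη j with h1 | h1
  · exact (hpair 0 j hj0.symm |>.symm |> fun h => (hpair j 0 hj0).2) (funext fun t => by
      have := hall t; rw [h0, h1] at this; rw [Pi.neg_apply]; linarith)
  · exact (hpair j 0 hj0).1 (funext fun t => by have := hall t; rw [h0, h1] at this; linarith)
  · exact (hpair j 0 hj0).1 (funext fun t => by have := hall t; rw [h0, h1] at this; linarith)
  · exact (hpair j 0 hj0).2 (funext fun t => by have := hall t; rw [h0, h1] at this; rw [Pi.neg_apply]; linarith)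

end Balanced

/-! ## §3 The exceptional `(2,2)`-class on `X₀ × X₁ × X₂ × X₃` -/

section Geometry

open scoped Classical

variable {K : Type} [Field K] [NumberField K] [IsCMField K] {Φ : Fin 4 → CMType K}
  {A : Fin 4 → AbelianVariety ℂ} {ι : ∀ i, 𝓞 K →+* End (A i)}
  {θ : ∀ i, K →+* Module.End ℂ (complexBetti (A i).X 1)}

/-- **Four pairwise inequivalent CM types of ONE CM field with a sign relation `Σ η_i u_{Φ_i} = 0`: the product
`X₀ × X₁ × X₂ × X₃` of ANY realisations carries a rational `(2,2)`-class outside the `ℂ`-span of products of divisor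
classes.** [cite: Dodson1984, §3.2 and Thm. 3.3] -/
theorem exists_exceptional_two_biproduct_of_signRelation
    (hpair : ∀ i j, i ≠ j → antiVec (Φ j).1 (1 : ℂ ≃+* ℂ) ≠ antiVec (Φ i).1 (1 : ℂ ≃+* ℂ) ∧
      antiVec (Φ j).1 (1 : ℂ ≃+* ℂ) ≠ -antiVec (Φ i).1 (1 : ℂ ≃+* ℂ))
    {η : Fin 4 → ℚ} (hη : ∀ i, η i = 1 ∨ η i = -1)
    (hrel : ∀ s : K →+* ℂ, ∑ i, η i * antiVec (Φ i).1 (1 : ℂ ≃+* ℂ) s = 0)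
    (hA : ∀ i, IsCMTypeRealisation (Φ i) (A i) (ι i) (θ i)) :
    ∃ c : complexBetti (⨁ A).X (2 * 2), IsRationalClass c ∧
      IsOfHodgeType (⨁ A).dim (⨁ A).X (2 * 2) 2 2 c ∧ c ∉ divisorClassesSpan (⨁ A).X (⨁ A).dim 2 := by
  classical
  obtain ⟨s⟩ : Nonempty (K →+* ℂ) := inferInstance
  exact (exists_exceptional_biproduct_iff (K := fun _ : Fin 4 => K) hA 2).2
    ⟨_, mem_pohlmannSetsAlg_two Φ hη hrel s, not_mem_pohlmannDivisorSetsAlg_two Φ hη hpair s⟩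

/-- **ANY SEXTIC CM field, any four pairwise inequivalent CM types (`Φ_j ∉ {Φ_i, Φ̄_i}`), any realisations: the 12-fold
`X₀ × X₁ × X₂ × X₃` carries a rational `(2,2)`-class outside the `ℂ`-span of products of divisor classes.** [cite: Dodson1984, §3.2 and Thm. 3.3] -/
theorem exists_exceptional_two_biproduct_of_finrank_eq_six (h6 : Module.finrank ℚ K = 6)
    (hpair : ∀ i j, i ≠ j → antiVec (Φ j).1 (1 : ℂ ≃+* ℂ) ≠ antiVec (Φ i).1 (1 : ℂ ≃+* ℂ) ∧
      antiVec (Φ j).1 (1 : ℂ ≃+* ℂ) ≠ -antiVec (Φ i).1 (1 : ℂ ≃+* ℂ))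
    (hA : ∀ i, IsCMTypeRealisation (Φ i) (A i) (ι i) (θ i)) :
    ∃ c : complexBetti (⨁ A).X (2 * 2), IsRationalClass c ∧
      IsOfHodgeType (⨁ A).dim (⨁ A).X (2 * 2) 2 2 c ∧ c ∉ divisorClassesSpan (⨁ A).X (⨁ A).dim 2 := by
  obtain ⟨η, hη, hrel⟩ := exists_sign_relation_of_finrank_eq_six h6 Φ hpair
  exact exists_exceptional_two_biproduct_of_signRelation hpair hη hrel hA

/-- **Four pairwise non-isogenous CM abelian threefolds `X₀, …, X₃` with CM by ONE sextic CM field `K`: the 12-fold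
`X₀ × X₁ × X₂ × X₃` carries a rational `(2,2)`-class which is not in the `ℂ`-span of products of divisor classes** — an
explicit Hodge class whose algebraicity is an open instance of the Hodge conjecture (for `K` without imaginary quadratic
subfield these are the four isogeny classes of simple CM threefolds with CM by `K`, cf. `CorCM/SexticCMFieldPairFlip`). [cite: Dodson1984, §3.2 and Thm. 3.3] -/
theorem exists_exceptional_two_biproduct_of_not_isIsogenous (h6 : Module.finrank ℚ K = 6)
    (hA : ∀ i, IsCMTypeRealisation (Φ i) (A i) (ι i) (θ i))
    (hniso : ∀ i j, i ≠ j → ¬AbelianVariety.IsIsogenous (A i) (A j)) :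
    ∃ c : complexBetti (⨁ A).X (2 * 2), IsRationalClass c ∧
      IsOfHodgeType (⨁ A).dim (⨁ A).X (2 * 2) 2 2 c ∧ c ∉ divisorClassesSpan (⨁ A).X (⨁ A).dim 2 :=
  exists_exceptional_two_biproduct_of_finrank_eq_six h6
    (fun i j hij => antiVec_ne_of_not_isIsogenous (hA i) (hA j) (hniso i j hij)) hA

end Geometry

end Literature.AlgebraicGeometry.ComplexMultiplication.GenericCMField
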